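import Literature.Barriers.CriticalPhenomena.LaceExpansionEtaZeroXSpaceLeafInputs
import Literature.Barriers.CriticalPhenomena.LaceExpansionDiagramBound7410
import Literature.Barriers.CriticalPhenomena.LaceExpansionXSpaceNormsProofs
import HarnessLib

/-!
# `Hara2008_etaZeroXSpace` (Heydenreich–van der Hofstad Thm. 11.4) from THREE leaf facts

Barrier catalogue `Literature/Barriers/CriticalPhenomena/` (D-0021), continuation of
`LaceExpansionEtaZeroXSpaceLeafInputs.lean` (`Hara2008_etaZeroXSpace_of_leafInputs`: five leaves).
Two of the five leaves are now THEOREMS of the catalogue —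
`HvdH2017_piNDiagramBoundPc_holds` (`LaceExpansionDiagramBound7410.lean`: the pointwise BK bound
(7.4.10) on the Hara–Slade coefficients at `p_c`) and `Hara2008_lemma17Pc_holds`
(`LaceExpansionXSpaceNormsProofs.lean`: Hara's Lemma 1.7) — so that `η = 0` in `x`-space for
`d ≥ 11` rests on exactly three named facts:

* `Hara2008_prop12Subcrit` — the subcritical lace expansion with `p`-uniform bounds (Hara 2008,
  Prop. 1.2 below `p_c`; reduced further in `LaceExpansionPcSubcritCoefficients.lean`,
  `LaceExpansionPcSubcritOfBounds.lean`, `LaceExpansionPcSubcritMajorant.lean` to `p`-uniform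
  `[1 - cos(k·x)]`-weighted bounds on `Π^{(N)}_p`, the finiteness of the critical diagrams and a
  smallness condition);
* `Hara2008_twoLongLinesDiagramBoundPc` — Hara's two-long-lines estimate (§3.5);
* `Hara2008_weightedNLoopBoundPc` — Hara's weighted `N`-loop estimate (§3.4).

## References

* T. Hara, Ann. Probab. 36 (2008) 530–593: Thm. 1.1, Prop. 1.2, Lemmas 1.5–1.7, §3.4–§3.5, §4,
  Appendix A.
* M. Heydenreich, R. van der Hofstad, *Progress in High-Dimensional Percolation and Random
  Graphs* (Springer 2017): Thm. 11.4, (7.4.10), Cor. 8.13.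
-/

noncomputable section

namespace Literature.Barriers.CriticalPhenomena

/-- **`Hara2008_laceExpansionPc` from three leaf facts** (`Hara2008_laceExpansionPc_of_leafInputs`
with `HvdH2017_piNDiagramBoundPc_holds` and `Hara2008_lemma17Pc_holds`).
[cite: Hara2008, §1.2, Lemmas 1.5–1.7, §3.4–§3.5 and Appendix A]
[cite: HeydenreichVanDerHofstad2017, (7.4.10)] -/
theorem Hara2008_laceExpansionPc_of_threeInputs (hS : Hara2008_prop12Subcrit)
    (hL : Hara2008_twoLongLinesDiagramBoundPc) (hW : Hara2008_weightedNLoopBoundPc) :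
    Hara2008_laceExpansionPc :=
  Hara2008_laceExpansionPc_of_leafInputs hS HvdH2017_piNDiagramBoundPc_holds hL hW
    Hara2008_lemma17Pc_holds

/-- **`η = 0` in `x`-space for `d ≥ 11` (Heydenreich–van der Hofstad Thm. 11.4) from three leaf
facts**: `Hara2008_prop12Subcrit`, `Hara2008_twoLongLinesDiagramBoundPc`,
`Hara2008_weightedNLoopBoundPc` — the complete list of unproved statements behind
`Hara2008_etaZeroXSpace` in the catalogue at this point (Hara's Gaussian lemma, the framework of
§1.2 and Appendix A, Lemma 1.7 and the diagrammatic bound (7.4.10) being theorems).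
[cite: Hara2008, Thm. 1.1, §1.2 and Appendix A] [cite: HeydenreichVanDerHofstad2017, Thm. 11.4 and pp. 137–139] -/
theorem Hara2008_etaZeroXSpace_of_threeInputs (hS : Hara2008_prop12Subcrit)
    (hL : Hara2008_twoLongLinesDiagramBoundPc) (hW : Hara2008_weightedNLoopBoundPc) :
    Hara2008_etaZeroXSpace :=
  Hara2008_etaZeroXSpace_of_leafInputs hS HvdH2017_piNDiagramBoundPc_holds hL hW
    Hara2008_lemma17Pc_holds

end Literature.Barriers.CriticalPhenomena

end
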